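import Literature.Probability.Percolation.KozmaNitzanHittable
import HarnessLib

/-!
# Kozma–Nitzan, Theorem 6 under H-reliability: the gluing hypothesis the printed proof uses

Proofs-and-definitions companion of
`KozmaNitzanReduction.lean` / `KozmaNitzanTargetLemma.lean` (G. Kozma, S. Nitzan, *A reduction of
the `θ(p_c) = 0` problem to a conjectured inequality*, arXiv:2401.12397, §4).

Conjecture 3 (p. 15) asks, for a source `0`, relays `A` and a target `b`, that `P(0 ↔ A) > 1 - δ`
and `P(a ↔ b) > 1 - δ` for all `a ∈ A` force `P(0 ↔ b) > 1 - ε`. The printed proof of Theorem 6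
(Conjecture 3 ⇒ `θ(p_c) = 0`, pp. 15–31) invokes Conjecture 3 at exactly one place, Step V of the
proof of Lemma 10 (p. 22), in the auxiliary graph `K_ξ`, with the source `o` lying OUTSIDE the
lattice subbox `D` (Lemma 10, p. 17: "for every vertex `o ∈ G \ D`") that contains the relay set
`A_ξ ⊆ S`, the target `T` and — by the definitions of a target (p. 16: `v + l(v)Q(v) ⊆ D`) and of the
scale `m` in (16) (p. 17) — every open path certifying in (22)–(24) that the relays are reliable to
the target. Consequently (see `KozmaNitzan.stepIV_in`, `KozmaNitzan.LHyp.stepV_in`,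
`KozmaNitzan.targetLemma_avoiding`) the whole proof runs on the WEAKER hypothesis in which the
relays are only assumed reliable to the target in the reference graph `H = G - o` of KN's
Question 9 (p. 36: "Let `H` be the graph given from `G` by removing all edges going out of `0`"):

* `KozmaNitzan.HGluing ε δ` — the `(ε, δ)`-instance of this hypothesis ("Conjecture 3H at
  `(ε, δ)`"), typed exactly like the body of `KozmaNitzan2024_conjecture3` with the relay
  reliabilities measured under the restricted weighting `restrW {0}ᶜ w` (this library's realisation
  of `H`, `KozmaNitzanHittable.lean`). The H-form of Theorem 6 is then the IMPLICATION
  `(∀ ε > 0, ∃ δ > 0, HGluing ε δ) → θ_{ℤ^d}(p_c) = 0`, obtained by feeding `targetProperty_of_hGluing`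
  (below) to the `TargetProperty`-threaded steps of `KozmaNitzanTheorem6.lean`
  (`exists_slab_theta_pos_of_target`) and the slab-criticality input of
  `KozmaNitzanTheorem6SlabCritical.lean` (it is not recorded as a single declaration); its antecedent — "Conjecture 3H" — is NOT printed by
  Kozma–Nitzan and is NOT asserted anywhere in this library: it is a WEAKENING of their open
  Conjecture 3 (`KozmaNitzan.hGluing_of_conjecture3`: Conjecture 3 ⇒ Conjecture 3H), recorded only as
  the hypothesis of theorems, never as a standalone statement.
* the transfers `KozmaNitzan.HGluing.fintype / .finSupp / .avoiding` — from `Fin n` to any finite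
  vertex type, to finitely supported weightings on a countable vertex type, and to the AVOIDING
  SCHEMA consumed by `KozmaNitzan.targetLemma_avoiding` (target SET `T`, relays reliable to `T`
  inside any region `Rg ∌ o`; wiring `T` to a point commutes with removing the edges at `o ∉ T`).
* `KozmaNitzan.TargetProperty d p` — the CONCLUSION of Lemma 10 as a property of the parameter
  `p` (the only interface between the gluing hypothesis and the rest of §4), with
  `targetProperty_of_conjecture3` / `targetProperty_of_hGluing`; the files
  `KozmaNitzanCorridor.lean`, `KozmaNitzanTheorem6.lean`, `KozmaNitzanTheorem6Split.lean` are
  threaded on it.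

## References

* G. Kozma, S. Nitzan, arXiv:2401.12397 (2024): Conjecture 3 and Theorem 6 (p. 15), Lemma 10 and
  its proof (pp. 17–22, esp. (16), (22)–(26) and Step V), Question 9 (p. 36, the graph `H`).
-/

noncomputable section

open MeasureTheory ProbabilityTheory
open scoped ENNReal

namespace Literature.Probability.Percolation

open LatticeModels SimpleGraph

namespace KozmaNitzan

/-- **H-gluing at `(ε, δ)`** ("Conjecture 3H" at the pair `(ε, δ)`): on every finite
weighted graph (vertex set `Fin n`, pair weights `w`), for every source `o`, relay set `A` and
target `b`: if `P_w(o ↔ A) > 1 - δ` and, for every relay `a ∈ A`, `P_H(a ↔ b) > 1 - δ` where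
`H = G - o` is the graph with all edges at `o` removed (the restricted weighting `restrW {o}ᶜ w`;
Kozma–Nitzan's reference graph `H` of Question 9, p. 36), then `P_w(o ↔ b) > 1 - ε`. Kozma–Nitzan's
display (p. 15) at `(ε, δ)` is the same with `P_G(a ↔ b) ≥ P_H(a ↔ b)` in place of `P_H`, whence
the implication recorded right below. A predicate in two real parameters; its `∀ ε, ∃ δ`-closure
is used in this library only on the left of an arrow (`targetProperty_of_hGluing`). [cite: KozmaNitzan2024, p. 15 (the display of Conj. 3) and p. 36 (Question 9, the graph H)] -/
def HGluing (ε δ : ℝ) : Prop :=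
  ∀ (n : ℕ) (w : Sym2 (Fin n) → unitInterval) (A : Finset (Fin n)) (o b : Fin n),
    1 - δ < (prodBernoulli w).real (⋃ a ∈ A, openConn o a) →
      (∀ a ∈ A, 1 - δ < (prodBernoulli (restrW ({o}ᶜ : Set (Fin n)) w)).real (openConn a b)) →
        1 - ε < (prodBernoulli w).real (openConn o b)

/-- **Conjecture 3 implies H-gluing** at every `ε > 0` for some `δ > 0` (removing the edges at `o`
only lowers `P(a ↔ b)`). [cite: KozmaNitzan2024, Conjecture 3 (p. 15); Question 9 (p. 36)] -/
theorem hGluing_of_conjecture3 (hC : KozmaNitzan2024_conjecture3) {ε : ℝ} (hε : 0 < ε) :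
    ∃ δ : ℝ, 0 < δ ∧ HGluing ε δ := by
  obtain ⟨δ, hδ, h⟩ := hC ε hε
  refine ⟨δ, hδ, fun n w A o b hoA hab => h n w A o b hoA fun a ha => (hab a ha).trans_le ?_⟩
  exact prodBernoulli_real_mono_of_isUpperSet (restrW_le _ w) (isUpperSet_openConn a b)
    (measurableSet_openConn_holds a b)

variable {V W : Type*}

/-- **Restriction of weights commutes with relabelling**: for injective `f : W → V`,
`restrW S w ∘ Sym2.map f = restrW (f ⁻¹' S) (w ∘ Sym2.map f)`. [folklore] -/
theorem restrW_comp_map {f : W → V} (hf : Function.Injective f) (S : Set V) (w : Sym2 V → unitInterval) :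
    restrW S w ∘ Sym2.map f = restrW (f ⁻¹' S) (w ∘ Sym2.map f) := by
  funext e
  induction e using Sym2.ind with
  | h a c =>
    simp only [Function.comp_apply, Sym2.map_mk]
    by_cases h : s(a, c) ∈ wireSet (f ⁻¹' S)
    · obtain ⟨ha, hc, hac⟩ := mk_mem_wireSet_iff.1 h
      have hS : s(f a, f c) ∈ wireSet S := mk_mem_wireSet_iff.2 ⟨ha, hc, hf.ne hac⟩
      rw [restrW_apply_of_mem _ h, restrW_apply_of_mem _ hS]
      rfl
    · have hS : s(f a, f c) ∉ wireSet S := fun h' => h (by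
        obtain ⟨ha, hc, hac⟩ := mk_mem_wireSet_iff.1 h'
        exact mk_mem_wireSet_iff.2 ⟨ha, hc, fun hac' => hac (congrArg f hac')⟩)
      rw [restrW_apply_of_not_mem _ h, restrW_apply_of_not_mem _ hS]

/-- The preimage of `{o}ᶜ` under a bijection. [folklore] -/
theorem equiv_symm_preimage_compl_singleton (e : V ≃ W) (o : V) :
    (e.symm : W → V) ⁻¹' ({o}ᶜ : Set V) = ({e o}ᶜ : Set W) := by
  ext x
  simp only [Set.mem_preimage, Set.mem_compl_iff, Set.mem_singleton_iff, Equiv.symm_apply_eq]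

/-- A weighting vanishing off the pairs inside `S` still does so after restriction. [folklore] -/
theorem restrW_eq_zero_of {S' : Set V} (w : Sym2 V → unitInterval) {e : Sym2 V} (he : w e = 0) :
    restrW S' w e = 0 := by
  by_cases h : e ∈ wireSet S'
  · rw [restrW_apply_of_mem _ h, he]
  · rw [restrW_apply_of_not_mem _ h]

/-- **H-gluing over every finite vertex type** (relabel along `Fintype.equivFin`; the restricted
weighting relabels to the restricted weighting, `restrW_comp_map`).
[cite: KozmaNitzan2024, Conjecture 3 (p. 15); Question 9 (p. 36)] -/
theorem HGluing.fintype (hC : ∀ ε : ℝ, 0 < ε → ∃ δ : ℝ, 0 < δ ∧ HGluing ε δ) {ε : ℝ} (hε : 0 < ε) :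
    ∃ δ : ℝ, 0 < δ ∧ ∀ (V : Type) [Fintype V] (w : Sym2 V → unitInterval)
      (A : Finset V) (o b : V),
      1 - δ < (prodBernoulli w).real (⋃ a ∈ A, openConn o a) →
        (∀ a ∈ A, 1 - δ < (prodBernoulli (restrW ({o}ᶜ : Set V) w)).real (openConn a b)) →
          1 - ε < (prodBernoulli w).real (openConn o b) := by
  obtain ⟨δ, hδ, h⟩ := hC ε hε
  refine ⟨δ, hδ, fun V _ w A o b hoA hab => ?_⟩
  classical
  set e := Fintype.equivFin V with he
  have hf : Function.Injective (e.symm : Fin (Fintype.card V) → V) := e.symm.injective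
  -- transport of connection probabilities, for any weighting
  have key : ∀ (u : Sym2 V → unitInterval) (x y : V),
      (prodBernoulli (u ∘ Sym2.map e.symm)).real (openConn (e x) (e y)) = (prodBernoulli u).real (openConn x y) := by
    intro u x y
    rw [← prodBernoulli_map_restrictConfig u hf, map_measureReal_apply (measurable_restrictConfig _)
      (measurableSet_openConn_holds _ _), restrictConfig_symm_preimage_openConn]
  set w' : Sym2 (Fin (Fintype.card V)) → unitInterval := w ∘ Sym2.map e.symm with hw'
  have keyU : (prodBernoulli w').real (⋃ a ∈ A.map e.toEmbedding, openConn (e o) a) =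
      (prodBernoulli w).real (⋃ a ∈ A, openConn o a) := by
    rw [hw', ← prodBernoulli_map_restrictConfig w hf, map_measureReal_apply (measurable_restrictConfig _)
      (Finset.measurableSet_biUnion _ fun a _ => measurableSet_openConn_holds _ _)]
    congr 1
    exact restrictConfig_symm_preimage_biUnion_openConn e o A
  have hrestr : restrW ({e o}ᶜ : Set (Fin (Fintype.card V))) w' = restrW ({o}ᶜ : Set V) w ∘ Sym2.map e.symm := by
    rw [hw', restrW_comp_map hf, equiv_symm_preimage_compl_singleton]
  have h1 := h (Fintype.card V) w' (A.map e.toEmbedding) (e o) (e b) (by rwa [keyU]) (by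
    intro a ha
    rw [Finset.mem_map_equiv] at ha
    have := hab (e.symm a) ha
    rwa [← key (restrW ({o}ᶜ : Set V) w), Equiv.apply_symm_apply, ← hrestr] at this)
  rwa [hw', key] at h1

/-- **H-gluing for finitely supported weights on a countable vertex type** (restriction to the
finite support `S`, on which the configuration a.s. lives; `o, b ∈ S`, `A ⊆ S`).
[cite: KozmaNitzan2024, Conjecture 3 (p. 15); Question 9 (p. 36)] -/
theorem HGluing.finSupp (hC : ∀ ε : ℝ, 0 < ε → ∃ δ : ℝ, 0 < δ ∧ HGluing ε δ) {ε : ℝ} (hε : 0 < ε) :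
    ∃ δ : ℝ, 0 < δ ∧ ∀ (V : Type) [Countable V] (w : Sym2 V → unitInterval) (S : Finset V),
      (∀ e : Sym2 V, (∃ x ∈ e, x ∉ S) → w e = 0) →
      ∀ (A : Finset V) (o b : V), A ⊆ S → o ∈ S → b ∈ S →
        1 - δ < (prodBernoulli w).real (⋃ a ∈ A, openConn o a) →
          (∀ a ∈ A, 1 - δ < (prodBernoulli (restrW ({o}ᶜ : Set V) w)).real (openConn a b)) →
            1 - ε < (prodBernoulli w).real (openConn o b) := by
  obtain ⟨δ, hδ, h⟩ := HGluing.fintype hC hε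
  refine ⟨δ, hδ, fun V _ w S hw A o b hAS ho hb hoA hab => ?_⟩
  classical
  set Sset : Set V := ↑S with hSset
  set f : Sset → V := Subtype.val with hf
  have hfi : Function.Injective f := Subtype.val_injective
  -- transport of connection probabilities, for any weighting vanishing off the pairs inside `S`
  have key : ∀ (u : Sym2 V → unitInterval), (∀ e : Sym2 V, (∃ x ∈ e, x ∉ S) → u e = 0) →
      ∀ (x y : V) (hx : x ∈ Sset) (hy : y ∈ Sset),
      (prodBernoulli (u ∘ Sym2.map f)).real (openConn (⟨x, hx⟩ : Sset) ⟨y, hy⟩) =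
        (prodBernoulli u).real (openConn x y) := by
    intro u hu x y hx hy
    have hae : ∀ᵐ ω ∂prodBernoulli u, ∀ e ∈ ω, ∀ x ∈ e, x ∈ Sset := by
      have hZ : ({e : Sym2 V | ∃ x ∈ e, x ∉ S}).Countable := Set.to_countable _
      filter_upwards [prodBernoulli_ae_forall_notMem u hZ fun e he => hu e he] with ω hω e he x hx
      by_contra hxS
      exact hω e ⟨x, hx, hxS⟩ he
    rw [← prodBernoulli_map_restrictConfig u hfi, map_measureReal_apply (measurable_restrictConfig _)
      (measurableSet_openConn_holds _ _)]
    refine measureReal_congr ?_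
    filter_upwards [hae] with ω hω
    refine propext ⟨fun h' => ?_, fun h' => ?_⟩
    · exact reachable_map_of_restrictConfig hfi ω h'
    · exact reachable_restrictConfig_subtype_of_reachable hω hx hy h'
  set w' : Sym2 Sset → unitInterval := w ∘ Sym2.map f with hw'
  have hae : ∀ᵐ ω ∂prodBernoulli w, ∀ e ∈ ω, ∀ x ∈ e, x ∈ Sset := by
    have hZ : ({e : Sym2 V | ∃ x ∈ e, x ∉ S}).Countable := Set.to_countable _
    filter_upwards [prodBernoulli_ae_forall_notMem w hZ fun e he => hw e he] with ω hω e he x hx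
    by_contra hxS
    exact hω e ⟨x, hx, hxS⟩ he
  set A' : Finset Sset := A.subtype (· ∈ Sset) with hA'
  have keyU : (prodBernoulli w').real (⋃ a ∈ A', openConn (⟨o, ho⟩ : Sset) a) =
      (prodBernoulli w).real (⋃ a ∈ A, openConn o a) := by
    rw [hw', ← prodBernoulli_map_restrictConfig w hfi, map_measureReal_apply (measurable_restrictConfig _)
      (Finset.measurableSet_biUnion _ fun a _ => measurableSet_openConn_holds _ _)]
    refine measureReal_congr ?_
    filter_upwards [hae] with ω hω
    change (ω ∈ restrictConfig f ⁻¹' (⋃ a ∈ A', openConn (⟨o, ho⟩ : Sset) a)) =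
      (ω ∈ ⋃ a ∈ A, openConn o a)
    simp only [Set.mem_preimage, Set.mem_iUnion, exists_prop, hA', Finset.mem_subtype, eq_iff_iff]
    constructor
    · rintro ⟨a, ha, h'⟩
      exact ⟨a, ha, reachable_map_of_restrictConfig hfi ω h'⟩
    · rintro ⟨a, ha, h'⟩
      exact ⟨⟨a, hAS ha⟩, ha, reachable_restrictConfig_subtype_of_reachable hω ho (hAS ha) h'⟩
  -- the restricted weighting restricts to the restricted weighting
  have hwH : ∀ e : Sym2 V, (∃ x ∈ e, x ∉ S) → restrW ({o}ᶜ : Set V) w e = 0 :=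
    fun e he => restrW_eq_zero_of w (hw e he)
  have hrestr : restrW ({(⟨o, ho⟩ : Sset)}ᶜ : Set Sset) w' = restrW ({o}ᶜ : Set V) w ∘ Sym2.map f := by
    rw [hw', restrW_comp_map hfi]
    congr 1
    ext x
    simp only [Set.mem_compl_iff, Set.mem_singleton_iff, Set.mem_preimage, hf]
    exact not_congr Subtype.ext_iff
  have h1 := h Sset w' A' ⟨o, ho⟩ ⟨b, hb⟩ (by rwa [keyU]) (by
    intro a ha
    rw [hA', Finset.mem_subtype] at ha
    have := hab a ha
    rwa [← key (restrW ({o}ᶜ : Set V) w) hwH a b a.2 hb, ← hrestr] at this)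
  rwa [hw', key w hw] at h1

/-- Wiring a set `T` to a point commutes with removing the edges at a vertex `o ∉ T`. [folklore] -/
theorem restrW_compl_singleton_wireW {T : Set V} {o : V} (ho : o ∉ T) (w : Sym2 V → unitInterval) :
    restrW ({o}ᶜ : Set V) (wireW T w) = wireW T (restrW ({o}ᶜ : Set V) w) := by
  classical
  funext e
  induction e using Sym2.ind with
  | h a c =>
    by_cases hT : s(a, c) ∈ wireSet T
    · obtain ⟨ha, hc, hac⟩ := mk_mem_wireSet_iff.1 hT
      have hH : s(a, c) ∈ wireSet ({o}ᶜ : Set V) :=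
        mk_mem_wireSet_iff.2 ⟨fun h => ho (h ▸ ha), fun h => ho (h ▸ hc), hac⟩
      rw [restrW_apply_of_mem _ hH, wireW_apply_of_mem _ hT, wireW_apply_of_mem _ hT]
    · rw [wireW_apply_of_not_mem _ hT]
      by_cases hH : s(a, c) ∈ wireSet ({o}ᶜ : Set V)
      · rw [restrW_apply_of_mem _ hH, restrW_apply_of_mem _ hH, wireW_apply_of_not_mem _ hT]
      · rw [restrW_apply_of_not_mem _ hH, restrW_apply_of_not_mem _ hH]

/-- **H-gluing in the AVOIDING form consumed by `KozmaNitzan.targetLemma_avoiding`**: for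
finitely supported weights on a countable vertex type, a source `o`, a target SET `T` and any region
`Rg ∌ o`: if `P_w(o ↔ A) > 1 - δ` and every relay is joined to `T` INSIDE `Rg` with probability
`> 1 - δ`, then `P_w(o ↔ T) > 1 - ε`. Proof: `{a ↔ T in Rg} ⊆ {a ↔ T in {o}ᶜ}`, whose probability is
`P_{restrW {o}ᶜ w}(a ↔ T)` (`prodBernoulli_restrW_real_biUnion_openConn`); wire `T` to a point
(`prodBernoulli_wireW_real_openConn`), which commutes with the restriction since `o ∉ T`
(`restrW_compl_singleton_wireW`), and apply `.finSupp` to the wired weights.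
[cite: KozmaNitzan2024, §4 p. 22 ("we identified the set T to a point"); Conjecture 3 (p. 15); Question 9 (p. 36)] -/
theorem HGluing.avoiding (hC : ∀ ε : ℝ, 0 < ε → ∃ δ : ℝ, 0 < δ ∧ HGluing ε δ) {ε : ℝ} (hε : 0 < ε) :
    ∃ δ : ℝ, 0 < δ ∧ ∀ (V : Type) [Countable V] (w : Sym2 V → unitInterval) (S : Finset V),
      (∀ e : Sym2 V, (∃ x ∈ e, x ∉ S) → w e = 0) →
      ∀ (A T : Finset V) (o : V) (Rg : Set V), A ⊆ S → T ⊆ S → o ∈ S → T.Nonempty → o ∉ Rg →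
        1 - δ < (prodBernoulli w).real (⋃ a ∈ A, openConn o a) →
          (∀ a ∈ A, 1 - δ < (prodBernoulli w).real (⋃ t ∈ T, openConnIn Rg a t)) →
            1 - ε < (prodBernoulli w).real (⋃ t ∈ T, openConn o t) := by
  obtain ⟨δ, hδ, h⟩ := HGluing.finSupp hC hε
  refine ⟨min δ 1, lt_min hδ one_pos, fun V _ w S hw A T o Rg hAS hTS ho hT hoRg hoA haT => ?_⟩
  classical
  obtain ⟨t₀, ht₀⟩ := hT
  have hδ' : 1 - δ ≤ 1 - min δ 1 := by linarith [min_le_left δ 1]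
  -- `o ∉ T`: otherwise the relay hypothesis at... no relay is needed; we show it from `Rg ∌ o` only
  -- through the relays: if `A = ∅` the hypothesis `P(o ↔ A) > 1 - δ ≥ 0` is violated.
  have hAne : A.Nonempty := by
    rw [Finset.nonempty_iff_ne_empty]
    rintro rfl
    simp only [Finset.notMem_empty, Set.iUnion_of_empty, Set.iUnion_empty, measureReal_empty] at hoA
    linarith [min_le_right δ 1]
  -- every relay lies in `Rg` (else `{a ↔ T in Rg} = ∅`), hence differs from `o`
  have haRg : ∀ a ∈ A, a ∈ Rg := by
    intro a ha
    by_contra haR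
    have h0 : (prodBernoulli w).real (⋃ t ∈ T, openConnIn Rg a t) = 0 := by
      rw [measureReal_eq_zero_iff (measure_ne_top _ _)]
      have : (⋃ t ∈ T, openConnIn Rg a t : Set (BondConfig V)) = ∅ := by
        ext ω
        simp only [Set.mem_iUnion, exists_prop, Set.mem_empty_iff_false, iff_false, not_exists, not_and]
        intro t _ hω
        exact haR hω.1
      rw [this, measure_empty]
    have := haT a ha
    rw [h0] at this
    linarith [min_le_right δ 1]
  have hao : ∀ a ∈ A, a ≠ o := fun a ha hao => hoRg (hao ▸ haRg a ha)
  -- the wired weights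
  set wT := wireW (↑T : Set V) w with hwT
  have hwT0 : ∀ e : Sym2 V, (∃ x ∈ e, x ∉ S) → wT e = 0 := by
    intro e he
    rw [hwT, wireW_apply_of_not_mem w ?_, hw e he]
    obtain ⟨x, hx, hxS⟩ := he
    exact fun h' => hxS (hTS (h'.1 x hx))
  -- case `o ∈ T`: the conclusion is trivial
  by_cases hoT : o ∈ T
  · have h1 : (prodBernoulli w).real (⋃ t ∈ T, openConn o t) = 1 := by
      have : (⋃ t ∈ T, openConn o t : Set (BondConfig V)) = Set.univ := by
        ext ω
        simp only [Set.mem_iUnion, exists_prop, Set.mem_univ, iff_true]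
        exact ⟨o, hoT, SimpleGraph.Reachable.refl _⟩
      rw [this, probReal_univ]
    rw [h1]; linarith
  have hoT' : o ∉ (↑T : Set V) := fun h' => hoT (Finset.mem_coe.1 h')
  -- apply `.finSupp` to the wired weights
  have h1 := h V wT S hwT0 A o t₀ hAS ho (hTS ht₀)
    (hoA.trans_le' (hδ'.trans_eq rfl) |>.trans_le
      (prodBernoulli_real_biUnion_openConn_mono (le_wireW _ w) o _)) (by
    intro a ha
    have e1 : (prodBernoulli (restrW ({o}ᶜ : Set V) wT)).real (openConn a t₀) =
        (prodBernoulli (restrW ({o}ᶜ : Set V) w)).real (⋃ t ∈ (↑T : Set V), openConn a t) := by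
      rw [hwT, restrW_compl_singleton_wireW hoT', prodBernoulli_wireW_real_openConn _ (↑T : Set V)
        (Finset.mem_coe.2 ht₀) a]
    have e2 : (prodBernoulli (restrW ({o}ᶜ : Set V) w)).real (⋃ t ∈ (↑T : Set V), openConn a t) =
        (prodBernoulli w).real (⋃ t ∈ (↑T : Set V), openConnIn ({o}ᶜ : Set V) a t) :=
      prodBernoulli_restrW_real_biUnion_openConn w ({o}ᶜ : Set V) (hao a ha) (↑T : Set V)
    have e3 : (prodBernoulli w).real (⋃ t ∈ T, openConnIn Rg a t) ≤
        (prodBernoulli w).real (⋃ t ∈ (↑T : Set V), openConnIn ({o}ᶜ : Set V) a t) := by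
      refine measureReal_mono (fun ω hω => ?_) (measure_ne_top _ _)
      simp only [Set.mem_iUnion, exists_prop, Finset.mem_coe] at hω ⊢
      obtain ⟨t, ht, hω⟩ := hω
      refine ⟨t, ht, ?_⟩
      rw [DCT16.mem_openConnIn_iff_pathIn] at hω ⊢
      exact hω.mono fun x hx hxo => hoRg (hxo ▸ hx)
    rw [e1, e2]
    exact hδ'.trans_lt ((haT a ha).trans_le e3))
  rwa [hwT, prodBernoulli_wireW_real_openConn w (↑T : Set V) (Finset.mem_coe.2 ht₀) o] at h1

/-! ## The target property: the conclusion of Lemma 10 as the interface to the rest of §4 -/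

variable {d : ℕ}

/-- **The target property at parameter `p`** — the conclusion of Kozma–Nitzan's Lemma 10 (p. 17)
for the lattice weighting of `ℤ^d` at `p`: for every `ε > 0` there is `δ > 0` such that for every
finite family `H` of hittable geometries there is `R` with: for every finitely supported weighting
`W` with a lattice subbox `D ⊇ B⟨R⟩` at parameter `p`, every nonempty target `T ⊆ D` w.r.t.
`(B, D, R, H)` and every source `o ∉ D`, `P_W(o ↔ B) > 1 - δ ⟹ P_W(o ↔ T) > 1 - ε`. A property
of `p`, the only interface between Lemma 10 and Lemmas 11–12 / the proof of Theorem 6, which are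
therefore threaded on it (`KozmaNitzanCorridor.lean`, `KozmaNitzanTheorem6.lean`); established from
Kozma–Nitzan's antecedent by Lemma 10 (`targetLemma`, the lemma right below) and from H-gluing by
`targetProperty_of_hGluing`. [cite: KozmaNitzan2024, §4 Lemma 10 (p. 17)] -/
def TargetProperty (d : ℕ) (p : unitInterval) : Prop :=
  ∀ ⦃ε : ℝ⦄, 0 < ε →
    ∃ δ : ℝ, 0 < δ ∧ ∀ H : List (Geom d), (∀ g ∈ H, IsHittable p g) → ∃ R : ℕ,
      ∀ (W : Sym2 (Site d) → unitInterval) (Sfin D : Finset (Site d)) (lo hi : Site d)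
        (T : Finset (Site d)) (o : Site d),
        FinSupp W Sfin → IsSubbox W p D → D ⊆ Sfin → o ∈ Sfin → o ∉ D →
        Finset.Icc (lo - (R : Site d)) (hi + (R : Site d)) ⊆ D →
        IsTarget T lo hi D R H → T ⊆ D → T.Nonempty →
        1 - δ < (prodBernoulli W).real (⋃ b ∈ Finset.Icc lo hi, openConn o b) →
          1 - ε < (prodBernoulli W).real (⋃ t ∈ T, openConn o t)

/-- **Lemma 10 from Conjecture 3**, as the target property. [cite: KozmaNitzan2024, §4 Lemma 10 (pp. 17–22)] -/
theorem targetProperty_of_conjecture3 [NeZero d] (hC : KozmaNitzan2024_conjecture3) (p : unitInterval)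
    (hp0 : 0 < (p : ℝ)) (hp1 : (p : ℝ) < 1) (hθ : 0 < theta (zdGraph d) 0 p) : TargetProperty d p :=
  fun _ hε => targetLemma hC p hp0 hp1 hθ hε

/-- **Lemma 10 from H-gluing**, as the target property: the avoiding schema of
`HGluing.avoiding` on `ℤ^d` feeds `targetLemma_avoiding`.
[cite: KozmaNitzan2024, §4 Lemma 10 (pp. 17–22); Question 9 (p. 36)] -/
theorem targetProperty_of_hGluing [NeZero d] (hC : ∀ ε : ℝ, 0 < ε → ∃ δ : ℝ, 0 < δ ∧ HGluing ε δ)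
    (p : unitInterval) (hp0 : 0 < (p : ℝ)) (hp1 : (p : ℝ) < 1) (hθ : 0 < theta (zdGraph d) 0 p) :
    TargetProperty d p := by
  intro ε hε
  refine targetLemma_avoiding (d := d) (fun ε' hε' => ?_) p hp0 hp1 hθ hε
  obtain ⟨δ, hδ, h⟩ := HGluing.avoiding hC hε'
  exact ⟨δ, hδ, fun w Sf hw A T o Rg hA hT ho hne hoRg hoA haT =>
    h (Site d) w Sf hw A T o Rg hA hT ho hne hoRg hoA haT⟩

end KozmaNitzan

end Literature.Probability.Percolation

end
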